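import Summits.QuantumFields.BalabanUV.T4Continuum.Support.ShellMeasureWindowSection

/-!
# `T4Continuum.ShellMeasureWindowSectionToy` — NON-VACUITY of the section-chart mechanism of
# `ShellMeasureWindowSection` on explicit data: a two-variable block, average `Q y = y₁ + y₂`, a MOVING NONLINEAR
# centre `σ(Q y)`, the print-shaped window about it; (M1) holds with `D = 1` at every threshold and the shell is LIVE
# (cell `pub-balaban`, sub-cell `t4`, spine estimate NE7c (node U5b); NE7c ROUND-2 crew `t4-ne7c-formalise-*`, seat
# leaf-10 (gen 3), companion of `ShellMeasureWindowSection` (p212366, FINDING F-ne7cleaf10-3); ADDITIVE — imports that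
# file only; a TOY: nothing of Bałaban's objects, 0 sorry, 0 cite)

HONEST FRAMING.  Finite four-torus programme, rung (B)+1 only — NOT infinite volume, NOT a mass gap, NOT the Clay
problem, NOT summit progress.  A toy: it asserts nothing about the audited series and moves no estimate; it shows that
the hypotheses of `ShellMeasureWindowSection` §2–§3 (linear splitting, measurable NONLINEAR section of the average,
window about the moving centre) are jointly inhabited by data for which the conclusion (M1) is non-trivial (live
shell).  NE7c ⇐ the named binders (c3); NE7c NOT PRINTED, NOT proved; spine PROVED 0/9.  HONEST DEPENDENCY (cell):
continuum YM on T⁴ ⇐ BetaPertH ∧ nine spine estimates (0/9 proved); BetaPertH ⇐ (D1) ∧ (D4) ∧ CAP+tail; G-an2-4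
gates asym, D1 and NE2/3/4.

THE TOY.  Block `E = ℝ × ℝ` (sup norm, Lebesgue measure), average `Q y = y.1 + y.2` onto `F = ℝ`, fibre model
`Kf = ℝ` with the splitting `Φ (x, b) = (x, b − x)` (`Q (Φ (x, b)) = b`, `Φ (x, 0) = (x, −x)`), the NONLINEAR section
`toySection b = (b/2 + sin b, b/2 − sin b)` (`Q ∘ toySection = id`, `toySection_average`; genuinely nonlinear,
`toySection_nonlinear`; the splitting `exists_toySplitting`), the tested variable `toyVar y = ‖y − toySection (Q y)‖` (distance from the centre READ OFF
THE BLOCK'S OWN AVERAGE — the marginal-reading shape of (1.26)/(1.27)) and the realized density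
`toyDensity r y = 1{toyVar y < r} · 1{|Q y| ≤ 1}` (the moving window × a cut-off in the average, so that the law is
finite).  RESULTS: `toy_chart_var` / `toy_chart_density` (through the section chart the variable is `|x|` and the
density is `1{|x| < r}·1{|b| ≤ 1}` — the window is a FIXED ball on the fibre), `slotAC_windowLebesgue` (the 1-D core:
(M1) with `D = 1` for Lebesgue restricted to `(−r, r)` and the variable `|x|`, EVERY real `θ`, `0 ≤ ρ ≤ 1`),
**`toy_slotAC`** — `SlotAntiConcentration (volume.withDensity (toyDensity r)) toyVar θ ρ 1` by
`ShellMeasureWindowSection.slotAC_of_sectionChart` ∘ `T4ShellMeasureLocal.slotAntiConcentration_of_sections` ∘ the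
1-D core — and **`toy_live`**: the shell `{θ(1−ρ) ≤ toyVar < θ}` has POSITIVE mass whenever `θ > 0`, `ρ ≤ 1` and
`θ(1−ρ) < min θ r` (via `measurePreserving_sectionChart`: the chart carries the product set
`(θ(1−ρ), min θ r) × [−1, 1]` into it).  In the END `slotAC_sectionWindow_of_levelData` the fibre-side (M1) comes from
E2′'s level data; here it is supplied by the elementary 1-D computation instead — the toy exercises the NEW mechanism
(disintegration along the average + moving window), not the one-depth assembly.
-/

noncomputable section

open Set Function MeasureTheory MeasureTheory.Measure Metric

namespace Summit.QuantumFields.BalabanUV.T4Continuum.ShellMeasureWindowSectionToy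

open scoped ENNReal
open Literature.MathematicalPhysics.QuantumFieldTheory.Balaban1983to89
open T4ShellMeasure (SlotAntiConcentration)
open T4ShellMeasureLocal (slotAntiConcentration_of_sections)
open T4ShellMeasureDet (withDensity_map_eq_map_withDensity_comp)
open ShellMeasureWindowSection (slotAC_of_sectionChart measurePreserving_sectionChart)

/-! ## §1 The toy data -/

/-- the toy's NONLINEAR SECTION of the average `Q y = y.1 + y.2`: `σ b = (b/2 + sin b, b/2 − sin b)` (a toy; nothing
of Bałaban's minimiser). [folklore] -/
def toySection (b : ℝ) : ℝ × ℝ := (b / 2 + Real.sin b, b / 2 - Real.sin b)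

/-- the toy's tested variable: sup-distance of the block variable from the centre read off ITS OWN average,
`‖y − σ(y.1 + y.2)‖`. [folklore] -/
def toyVar (y : ℝ × ℝ) : ℝ := ‖y - toySection (y.1 + y.2)‖

/-- the toy's realized density: the print-shaped window of radius `r` about the MOVING centre times the cut-off
`|y.1 + y.2| ≤ 1` in the average (finite total mass). [folklore] -/
def toyDensity (r : ℝ) (y : ℝ × ℝ) : ℝ≥0∞ :=
  {y : ℝ × ℝ | toyVar y < r}.indicator 1 y * {y : ℝ × ℝ | |y.1 + y.2| ≤ 1}.indicator 1 y

/-- `σ` IS a section of the average: `(σ b).1 + (σ b).2 = b`. [folklore] -/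
theorem toySection_average (b : ℝ) : (toySection b).1 + (toySection b).2 = b := by
  simp only [toySection]; ring

/-- the section is genuinely NONLINEAR (so the centre is neither fixed nor a linear read-out of the average):
`σ(2·(π/2)) ≠ 2·σ(π/2)`. [folklore] -/
theorem toySection_nonlinear : toySection (2 * (Real.pi / 2)) ≠ (2 : ℝ) • toySection (Real.pi / 2) := by
  intro h
  have h1 := congrArg Prod.fst h
  simp only [toySection, Prod.smul_mk, smul_eq_mul] at h1
  rw [show 2 * (Real.pi / 2) = Real.pi by ring, Real.sin_pi, Real.sin_pi_div_two] at h1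
  linarith

/-- `σ` is continuous (hence measurable). [folklore] -/
theorem continuous_toySection : Continuous toySection := by
  unfold toySection; fun_prop

/-- the tested variable is continuous. [folklore] -/
theorem continuous_toyVar : Continuous toyVar := by
  unfold toyVar
  exact (continuous_id.sub (continuous_toySection.comp (continuous_fst.add continuous_snd))).norm

/-- the density is measurable. [folklore] -/
theorem measurable_toyDensity (r : ℝ) : Measurable (toyDensity r) := by
  unfold toyDensity
  refine (measurable_one.indicator ?_).mul (measurable_one.indicator ?_)
  · exact measurableSet_lt continuous_toyVar.measurable measurable_const
  · exact measurableSet_le (continuous_fst.add continuous_snd).abs.measurable measurable_const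

/-- the toy's LINEAR SPLITTING of `ℝ × ℝ` along the average: `Φ (x, b) = (x, b − x)`, so that `Φ (x, 0) = (x, −x)`
spans the fibre `{y.1 + y.2 = 0}` and the second chart coordinate of `y` is its average `y.1 + y.2`. [folklore] -/
theorem exists_toySplitting : ∃ Φ : (ℝ × ℝ) ≃L[ℝ] (ℝ × ℝ),
    (∀ x : ℝ, Φ (x, 0) = (x, -x)) ∧ ∀ y : ℝ × ℝ, (Φ.symm y).2 = y.1 + y.2 := by
  let Φl : (ℝ × ℝ) ≃ₗ[ℝ] (ℝ × ℝ) :=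
    { toFun := fun p => (p.1, p.2 - p.1)
      map_add' := fun p q => Prod.ext rfl (by simp only [Prod.fst_add, Prod.snd_add]; ring)
      map_smul' := fun c p => Prod.ext rfl (by
        simp only [Prod.smul_fst, Prod.smul_snd, smul_eq_mul, RingHom.id_apply]; ring)
      invFun := fun y => (y.1, y.1 + y.2)
      left_inv := fun p => Prod.ext rfl (by ring)
      right_inv := fun y => Prod.ext rfl (by ring) }
  refine ⟨Φl.toContinuousLinearEquiv, fun x => ?_, fun y => rfl⟩
  show Φl (x, 0) = (x, -x)
  exact Prod.ext rfl (by show (0 : ℝ) - x = -x; ring)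

/-! ## §2 Through the section chart: the variable is `|x|`, the window a FIXED ball on the fibre -/

/-- the charted point `σ b + (x, −x)` has average `b`. [folklore] -/
theorem toy_chart_average (x b : ℝ) : (toySection b + (x, -x)).1 + (toySection b + (x, -x)).2 = b := by
  simp only [toySection, Prod.fst_add, Prod.snd_add]; ring

/-- through the chart the tested variable is the fibre coordinate's size: `toyVar (σ b + (x, −x)) = |x|`. [folklore] -/
theorem toy_chart_var (x b : ℝ) : toyVar (toySection b + (x, -x)) = |x| := by
  unfold toyVar
  rw [toy_chart_average, add_sub_cancel_left, Prod.norm_mk, Real.norm_eq_abs, Real.norm_eq_abs, abs_neg, max_self]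

/-- through the chart the density is `1{|x| < r} · 1{|b| ≤ 1}` — the moving window has become a FIXED ball in the
fibre coordinate. [folklore] -/
theorem toy_chart_density (r x b : ℝ) :
    toyDensity r (toySection b + (x, -x)) =
      {x : ℝ | |x| < r}.indicator 1 x * {b : ℝ | |b| ≤ 1}.indicator 1 b := by
  unfold toyDensity
  congr 1
  · by_cases hx : |x| < r
    · rw [indicator_of_mem (show toySection b + (x, -x) ∈ {y : ℝ × ℝ | toyVar y < r} by
        simpa only [mem_setOf_eq, toy_chart_var] using hx), indicator_of_mem (show x ∈ {x : ℝ | |x| < r} from hx)]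
      rfl
    · rw [indicator_of_notMem (show toySection b + (x, -x) ∉ {y : ℝ × ℝ | toyVar y < r} by
        simpa only [mem_setOf_eq, toy_chart_var] using hx), indicator_of_notMem (show x ∉ {x : ℝ | |x| < r} from hx)]
  · by_cases hb : |b| ≤ 1
    · rw [indicator_of_mem (show toySection b + (x, -x) ∈ {y : ℝ × ℝ | |y.1 + y.2| ≤ 1} by
        simpa only [mem_setOf_eq, toy_chart_average] using hb), indicator_of_mem (show b ∈ {b : ℝ | |b| ≤ 1} from hb)]
      rfl
    · rw [indicator_of_notMem (show toySection b + (x, -x) ∉ {y : ℝ × ℝ | |y.1 + y.2| ≤ 1} by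
        simpa only [mem_setOf_eq, toy_chart_average] using hb),
        indicator_of_notMem (show b ∉ {b : ℝ | |b| ≤ 1} from hb)]

/-! ## §3 The one-dimensional core: (M1) with `D = 1` for the windowed Lebesgue law on the fibre -/

/-- **THE 1-D CORE.**  For Lebesgue measure restricted to the window `(−r, r)` and the variable `|x|`, (M1) holds with
`D = 1` at EVERY threshold `θ` and width `0 ≤ ρ ≤ 1`: the shell `{θ(1−ρ) ≤ |x| < θ} ∩ (−r, r)` has length
`≤ 2ρ·min(θ, r) ≤ ρ · 2r`. [folklore] -/
theorem slotAC_windowLebesgue {r θ ρ : ℝ} (hr : 0 < r) (hρ0 : 0 ≤ ρ) (hρ1 : ρ ≤ 1) :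
    SlotAntiConcentration ((volume : Measure ℝ).restrict {x : ℝ | |x| < r}) (fun x => |x|) θ ρ 1 := by
  have hS : MeasurableSet {x : ℝ | |x| < r} := measurableSet_lt continuous_abs.measurable measurable_const
  have hsh : MeasurableSet {x : ℝ | θ * (1 - ρ) ≤ |x| ∧ |x| < θ} :=
    (measurableSet_le measurable_const continuous_abs.measurable).inter
      (measurableSet_lt continuous_abs.measurable measurable_const)
  unfold SlotAntiConcentration
  rw [Measure.restrict_apply hsh, Measure.restrict_apply_univ, one_mul]
  -- the window is the interval `(−r, r)`
  have hwin : {x : ℝ | |x| < r} = Ioo (-r) r := by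
    ext x; simp only [mem_setOf_eq, mem_Ioo, abs_lt]
  -- the shell inside the window lies in two intervals of length `min θ r − θ(1−ρ)`
  set m := min θ r with hm
  have hsub : {x : ℝ | θ * (1 - ρ) ≤ |x| ∧ |x| < θ} ∩ {x : ℝ | |x| < r} ⊆
      Ico (θ * (1 - ρ)) m ∪ Ioc (-m) (-(θ * (1 - ρ))) := by
    rintro x ⟨⟨h1, h2⟩, h3⟩
    simp only [mem_setOf_eq] at h3
    have hxm : |x| < m := lt_min h2 h3
    rcases le_or_gt 0 x with hx | hx
    · left
      rw [abs_of_nonneg hx] at h1 hxm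
      exact ⟨h1, hxm⟩
    · right
      rw [abs_of_neg hx] at h1 hxm
      exact ⟨by linarith, by linarith⟩
  have hlen : m - θ * (1 - ρ) ≤ ρ * r := by
    have hmθ : m ≤ θ := min_le_left _ _
    have hmr : m ≤ r := min_le_right _ _
    nlinarith
  calc volume ({x : ℝ | θ * (1 - ρ) ≤ |x| ∧ |x| < θ} ∩ {x : ℝ | |x| < r})
      ≤ volume (Ico (θ * (1 - ρ)) m ∪ Ioc (-m) (-(θ * (1 - ρ)))) := measure_mono hsub
    _ ≤ volume (Ico (θ * (1 - ρ)) m) + volume (Ioc (-m) (-(θ * (1 - ρ)))) := measure_union_le _ _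
    _ = ENNReal.ofReal (m - θ * (1 - ρ)) + ENNReal.ofReal (m - θ * (1 - ρ)) := by
        rw [Real.volume_Ico, Real.volume_Ioc]; ring_nf
    _ ≤ ENNReal.ofReal (ρ * r) + ENNReal.ofReal (ρ * r) := by
        gcongr
    _ = ENNReal.ofReal ρ * volume {x : ℝ | |x| < r} := by
        rw [hwin, Real.volume_Ioo, ← ENNReal.ofReal_add (by positivity) (by positivity),
          ← ENNReal.ofReal_mul hρ0]
        ring_nf

/-! ## §4 (M1) for the toy block law with the moving window, and liveness of the shell -/

/-- **THE TOY FIRES `slotAC_of_sectionChart`: (M1) with `D = 1` for Lebesgue measure on `ℝ × ℝ` tilted by the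
window about the MOVING NONLINEAR centre `σ(y.1 + y.2)` (times the cut-off in the average), tested variable = the
distance from that centre; every `θ`, `0 ≤ ρ ≤ 1`, `r > 0`.**  Proof: the splitting `Φ (x, b) = (x, b − x)` and
the section `σ` satisfy the hypotheses of `ShellMeasureWindowSection.slotAC_of_sectionChart`; through the chart the
density is `1{|x| < r}·1{|b| ≤ 1}` and the variable `|x|` (§2); sections over `b`
(`T4ShellMeasureLocal.slotAntiConcentration_of_sections`) and the 1-D core (§3). [folklore] -/
theorem toy_slotAC {r θ ρ : ℝ} (hr : 0 < r) (hρ0 : 0 ≤ ρ) (hρ1 : ρ ≤ 1) :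
    SlotAntiConcentration ((volume : Measure (ℝ × ℝ)).withDensity (toyDensity r)) toyVar θ ρ 1 := by
  -- the splitting `Φ (x, b) = (x, b − x)` and the section property of `σ` in the chart
  obtain ⟨Φ, hΦ0, hΦs⟩ := exists_toySplitting
  have hσ : ∀ b, (Φ.symm (toySection b)).2 = b := fun b => by rw [hΦs, toySection_average]
  refine slotAC_of_sectionChart volume volume volume Φ continuous_toySection.measurable hσ
    (measurable_toyDensity r) continuous_toyVar.measurable ?_
  -- through the chart: density `1{|x| < r}·1{|b| ≤ 1}`, variable `|x|`
  have hd : (fun p : ℝ × ℝ => toyDensity r (toySection p.2 + Φ (p.1, 0))) =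
      fun p => {x : ℝ | |x| < r}.indicator 1 p.1 * {b : ℝ | |b| ≤ 1}.indicator 1 p.2 := by
    funext p; rw [hΦ0, toy_chart_density]
  have hv : (fun p : ℝ × ℝ => toyVar (toySection p.2 + Φ (p.1, 0))) = fun p => |p.1| := by
    funext p; rw [hΦ0, toy_chart_var]
  rw [hd, hv]
  have hS : MeasurableSet {x : ℝ | |x| < r} := measurableSet_lt continuous_abs.measurable measurable_const
  have hB : MeasurableSet {b : ℝ | |b| ≤ 1} := measurableSet_le continuous_abs.measurable measurable_const
  refine slotAntiConcentration_of_sections volume volume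
    (f := fun p : ℝ × ℝ => {x : ℝ | |x| < r}.indicator 1 p.1 * {b : ℝ | |b| ≤ 1}.indicator 1 p.2)
    (((measurable_one.indicator hS).comp measurable_fst).mul ((measurable_one.indicator hB).comp measurable_snd))
    (u := fun p : ℝ × ℝ => |p.1|) (continuous_abs.measurable.comp measurable_fst) fun b => ?_
  -- per average value `b`
  show SlotAntiConcentration
    ((volume : Measure ℝ).withDensity fun x => {x : ℝ | |x| < r}.indicator 1 x * {b : ℝ | |b| ≤ 1}.indicator 1 b)
    (fun x => |x|) θ ρ 1
  by_cases hb : |b| ≤ 1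
  · have hdens : (fun x : ℝ => {x : ℝ | |x| < r}.indicator (1 : ℝ → ℝ≥0∞) x * {b : ℝ | |b| ≤ 1}.indicator 1 b) =
        {x : ℝ | |x| < r}.indicator 1 := by
      funext x; rw [indicator_of_mem (show b ∈ {b : ℝ | |b| ≤ 1} from hb), Pi.one_apply, mul_one]
    rw [hdens, withDensity_indicator_one hS]
    exact slotAC_windowLebesgue hr hρ0 hρ1
  · have hdens : (fun x : ℝ => {x : ℝ | |x| < r}.indicator (1 : ℝ → ℝ≥0∞) x * {b : ℝ | |b| ≤ 1}.indicator 1 b) =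
        0 := by
      funext x; rw [indicator_of_notMem (show b ∉ {b : ℝ | |b| ≤ 1} from hb), mul_zero, Pi.zero_apply]
    rw [hdens, withDensity_zero]
    unfold SlotAntiConcentration
    simp only [Measure.coe_zero, Pi.zero_apply, mul_zero, le_refl]

/-- **THE SHELL IS LIVE.**  For `θ > 0`, `ρ ≤ 1` and `θ(1−ρ) < min θ r` (so `ρ > 0`) the shell `{θ(1−ρ) ≤ toyVar < θ}` has POSITIVE
mass under the toy law — (M1) above is not satisfied vacuously.  Proof: the section chart is measure preserving onto
`c • volume` (`ShellMeasureWindowSection.measurePreserving_sectionChart`, `c ≠ 0`) and pulls the shell back to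
`{θ(1−ρ) ≤ |x| < θ}`, which carries the product set `(θ(1−ρ), min θ r) × [−1, 1]` of positive Lebesgue measure
inside the support of the pulled-back density. [folklore] -/
theorem toy_live {r θ ρ : ℝ} (hθ : 0 < θ) (hρ1 : ρ ≤ 1) (hlive : θ * (1 - ρ) < min θ r) :
    0 < ((volume : Measure (ℝ × ℝ)).withDensity (toyDensity r))
      {y : ℝ × ℝ | θ * (1 - ρ) ≤ toyVar y ∧ toyVar y < θ} := by
  -- the splitting and the section property, as in `toy_slotAC`
  obtain ⟨Φ, hΦ0, hΦs⟩ := exists_toySplitting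
  have hσ : ∀ b, (Φ.symm (toySection b)).2 = b := fun b => by rw [hΦs, toySection_average]
  obtain ⟨c, hc0, -, he⟩ :=
    measurePreserving_sectionChart volume volume (volume : Measure (ℝ × ℝ)) Φ continuous_toySection.measurable hσ
  -- the shell set and its pull-back
  have hA : MeasurableSet {y : ℝ × ℝ | θ * (1 - ρ) ≤ toyVar y ∧ toyVar y < θ} :=
    (measurableSet_le measurable_const continuous_toyVar.measurable).inter
      (measurableSet_lt continuous_toyVar.measurable measurable_const)
  have hpre : (fun p : ℝ × ℝ => toySection p.2 + Φ (p.1, 0)) ⁻¹' {y : ℝ × ℝ | θ * (1 - ρ) ≤ toyVar y ∧ toyVar y < θ}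
      = {p : ℝ × ℝ | θ * (1 - ρ) ≤ |p.1| ∧ |p.1| < θ} := by
    ext p; simp only [mem_preimage, mem_setOf_eq, hΦ0, toy_chart_var]
  -- transport: `c · (vol.withDensity D)(A) = (vol.prod vol).withDensity (D ∘ chart) (chart ⁻¹' A)`
  have hmap : ((c • (volume : Measure (ℝ × ℝ))).withDensity (toyDensity r))
      {y : ℝ × ℝ | θ * (1 - ρ) ≤ toyVar y ∧ toyVar y < θ} =
      (((volume : Measure ℝ).prod volume).withDensity
        ((toyDensity r) ∘ fun p : ℝ × ℝ => toySection p.2 + Φ (p.1, 0)))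
        {p : ℝ × ℝ | θ * (1 - ρ) ≤ |p.1| ∧ |p.1| < θ} := by
    rw [← he.map_eq, withDensity_map_eq_map_withDensity_comp he.measurable (measurable_toyDensity r),
      Measure.map_apply he.measurable hA, hpre]
  rw [withDensity_smul_measure, Measure.smul_apply, smul_eq_mul] at hmap
  -- a product set of positive measure inside the pulled-back shell, on which the pulled-back density is `1`
  set m := min θ r with hm
  have hmθ : m ≤ θ := min_le_left _ _
  have hmr : m ≤ r := min_le_right _ _
  have ha0 : 0 ≤ θ * (1 - ρ) := mul_nonneg hθ.le (by linarith)
  have hsub : Ioo (θ * (1 - ρ)) m ×ˢ Icc (-1 : ℝ) 1 ⊆ {p : ℝ × ℝ | θ * (1 - ρ) ≤ |p.1| ∧ |p.1| < θ} := by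
    rintro ⟨x, b⟩ ⟨⟨hx1, hx2⟩, -⟩
    have hx0 : 0 ≤ x := ha0.trans hx1.le
    simp only [mem_setOf_eq, abs_of_nonneg hx0]
    exact ⟨hx1.le, lt_of_lt_of_le hx2 hmθ⟩
  have hone : ∀ p ∈ Ioo (θ * (1 - ρ)) m ×ˢ Icc (-1 : ℝ) 1,
      ((toyDensity r) ∘ fun p : ℝ × ℝ => toySection p.2 + Φ (p.1, 0)) p = 1 := by
    rintro ⟨x, b⟩ ⟨⟨hx1, hx2⟩, hb⟩
    have hx0 : 0 ≤ x := ha0.trans hx1.le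
    have hxr : |x| < r := by rw [abs_of_nonneg hx0]; exact lt_of_lt_of_le hx2 hmr
    have hb' : |b| ≤ 1 := abs_le.2 ⟨hb.1, hb.2⟩
    simp only [comp_apply, hΦ0, toy_chart_density]
    rw [indicator_of_mem (show x ∈ {x : ℝ | |x| < r} from hxr), indicator_of_mem (show b ∈ {b : ℝ | |b| ≤ 1} from hb'),
      Pi.one_apply, Pi.one_apply, mul_one]
  have hprod : MeasurableSet (Ioo (θ * (1 - ρ)) m ×ˢ Icc (-1 : ℝ) 1) := measurableSet_Ioo.prod measurableSet_Icc
  have hpos : 0 < (((volume : Measure ℝ).prod volume).withDensity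
      ((toyDensity r) ∘ fun p : ℝ × ℝ => toySection p.2 + Φ (p.1, 0))) (Ioo (θ * (1 - ρ)) m ×ˢ Icc (-1 : ℝ) 1) := by
    rw [withDensity_apply _ hprod, setLIntegral_congr_fun hprod hone, lintegral_const, Measure.restrict_apply_univ,
      one_mul, Measure.prod_prod, Real.volume_Ioo, Real.volume_Icc]
    refine ENNReal.mul_pos (ne_of_gt ?_) (ne_of_gt ?_)
    · exact ENNReal.ofReal_pos.2 (by linarith)
    · exact ENNReal.ofReal_pos.2 (by norm_num)
  have hpos' : 0 < c * ((volume : Measure (ℝ × ℝ)).withDensity (toyDensity r))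
      {y : ℝ × ℝ | θ * (1 - ρ) ≤ toyVar y ∧ toyVar y < θ} := by
    rw [hmap]
    exact lt_of_lt_of_le hpos (measure_mono hsub)
  exact pos_iff_ne_zero.2 fun h0 => (ne_of_gt hpos') (by rw [h0, mul_zero])

end Summit.QuantumFields.BalabanUV.T4Continuum.ShellMeasureWindowSectionToy

end
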